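import Summits.MatrixMultiplication.MatrixMultiplication.Theorems.OctaveBudgetFivePatternDiagonal
import HarnessLib

/-!
# OctaveBudgetFivePattern — the FULL first power of `CW_q` (scalar blocks included), part 2:
the analytic threshold, the packing certificate and the certificate checker `fp_cert`
(decomp-mm cell, lens 5, generation 11; part 3 of 4 of the kernel-rungs file of generations 4–10; support
machinery for items `stmt-MatrixMultiplication-26290`, `26291`, `25359` of
`route-MatrixMultiplication-OctaveBudget`, closed in `OctaveBudgetFivePatternCerts.lean`)

Continuing `OctaveBudgetFivePatternDiagonal.lean` (five-pattern type `(a·m, a·m, b·m ; c·m, 0, c·m)`,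
`n = 2a+b+2c`, `k·a ≤ b`):

* §3 `fp_threshold`: the analytic threshold with a general per-coordinate entropy `h` and base `q^{a m}`
  (`loss_le_exp_n`);
* §4 `fp_packing`, `fp_omegaRect_le`: the packing certificate of the type and, through the tree's
  `mul_rpow_omegaRect_le_asymptoticRank` / `asymptoticRank_bigCwTensor_le`,
  **`ω(1,1,k) ≤ n (log(q+2) − min(H_X, H_Y)) / (a log q)`**;
* §5 `fp_cert`: the CERTIFICATE CHECKER — `e(k) ≤ η` follows from two log-linear inequalities
  (`mul_negMulLog_div` clears the entropies into logarithms of naturals), which after clearing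
  denominators are two comparisons of products of integer powers, decided by `norm_num` in the
  certificates file.

References: [cite: CoppersmithWinograd1990, §6–§7]; [cite: HuangPan1998, §8]; [cite: BurgisserClausenShokrollahi1997, §15.7–§15.8].
-/

set_option linter.dupNamespace false -- `MatrixMultiplication.MatrixMultiplication` (summit = problem, D-0017)

noncomputable section

namespace Summit.MatrixMultiplication.MatrixMultiplication.Theorems.OctaveBudgetFivePattern

open scoped BigOperators
open Finset
open Literature.Computability.AlgebraicComplexity
open Literature.Barriers.MatrixMultiplication
open Summit.MatrixMultiplication.MatrixMultiplication.Theorems.PerfectAmortisation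
  (stub_cwRectRestriction)

/-! ### §3  The analytic threshold with a general per-coordinate entropy `h` and base `q^{a m}` -/

/-- The subexponential loss `(N+1)^63 · 192 · exp(4 √(log 6 + N log 27))` with `N = n·M` is at most
`exp(κ·M)` once `(126 √(n+1) + 4 √(log 6 + n log 27)) · √M + log 192 ≤ κ·M`. [folklore] -/
theorem loss_le_exp_n {n M κ : ℝ} (hn : 0 ≤ n) (hM : 1 ≤ M)
    (hbound : (126 * √(n + 1) + 4 * √(Real.log 6 + n * Real.log 27)) * √M +
      Real.log 192 ≤ κ * M) :
    (n * M + 1) ^ 63 * 192 * Real.exp (4 * √(Real.log 6 + n * M * Real.log 27)) ≤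
      Real.exp (κ * M) := by
  have h6 : 0 ≤ Real.log 6 := Real.log_nonneg (by norm_num)
  have h27 : 0 ≤ Real.log 27 := Real.log_nonneg (by norm_num)
  have hX : 0 ≤ Real.log 6 + n * Real.log 27 := add_nonneg h6 (by positivity)
  have hM0 : 0 ≤ M := zero_le_one.trans hM
  have hN0 : 0 < n * M + 1 := by positivity
  have hN1 : n * M + 1 ≤ (n + 1) * M := by nlinarith
  have hlog : Real.log (n * M + 1) ≤ 2 * √(n * M + 1) := log_le_two_mul_sqrt hN0
  have hs1 : √(n * M + 1) ≤ √(n + 1) * √M := by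
    rw [← Real.sqrt_mul (by positivity)]
    exact Real.sqrt_le_sqrt hN1
  have hin : Real.log 6 + n * M * Real.log 27 ≤ (Real.log 6 + n * Real.log 27) * M := by
    nlinarith
  have hs2 : √(Real.log 6 + n * M * Real.log 27) ≤ √(Real.log 6 + n * Real.log 27) * √M := by
    rw [← Real.sqrt_mul hX]
    exact Real.sqrt_le_sqrt hin
  rw [← Real.log_le_iff_le_exp (by positivity), Real.log_mul (by positivity) (by positivity),
    Real.log_mul (by positivity) (by positivity), Real.log_pow, Real.log_exp]
  push_cast
  linarith [hlog, hs1, hs2, hbound]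

/-- **Analytic threshold, general form**: for `q ≥ 2`, `n, a ≥ 1`, any real `h` and `δ > 0` there is
`m ≥ 1` such that, with `N = n·m`, every `V : ℕ` with `exp(N·h) ≤ V · loss(N)` satisfies
`(q+2)^N ≤ V · (q^{a m})^(n (log(q+2) − h)/(a log q) + δ)`. [folklore] -/
theorem fp_threshold (q n a : ℕ) (hq : 2 ≤ q) (_hn : 1 ≤ n) (ha : 1 ≤ a) (h δ : ℝ) (hδ : 0 < δ) :
    ∃ m : ℕ, 1 ≤ m ∧ ∀ V : ℕ,
      Real.exp ((((n * m : ℕ) : ℝ)) * h) ≤ (V : ℝ) * ((((n * m : ℕ) : ℝ)) + 1) ^ 63 * 192 *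
          Real.exp (4 * Real.sqrt (Real.log 6 + (((n * m : ℕ) : ℝ)) * Real.log 27)) →
      ((q : ℝ) + 2) ^ (n * m) ≤ (V : ℝ) * ((q ^ (a * m) : ℕ) : ℝ) ^
          ((n : ℝ) * (Real.log ((q : ℝ) + 2) - h) / ((a : ℝ) * Real.log (q : ℝ)) + δ) := by
  have hq1 : (1 : ℝ) < q := by exact_mod_cast (lt_of_lt_of_le one_lt_two hq)
  have hq0 : (0 : ℝ) < q := zero_lt_one.trans hq1
  have hL : 0 < Real.log (q : ℝ) := Real.log_pos hq1
  have hn0 : (0 : ℝ) ≤ n := Nat.cast_nonneg n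
  have ha0 : (0 : ℝ) < a := by exact_mod_cast (by omega : 0 < a)
  have hrate : 0 < δ * a * Real.log (q : ℝ) := by positivity
  obtain ⟨m₀, hm₀⟩ := exists_nat_forall_sqrt_le
    (126 * √((n : ℝ) + 1) + 4 * √(Real.log 6 + (n : ℝ) * Real.log 27)) (Real.log 192)
    (δ * a * Real.log (q : ℝ)) hrate
  obtain ⟨m, hm1, hmm⟩ : ∃ m : ℕ, 1 ≤ m ∧
      (126 * √((n : ℝ) + 1) + 4 * √(Real.log 6 + (n : ℝ) * Real.log 27)) * √(m : ℝ) +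
        Real.log 192 ≤ δ * a * Real.log (q : ℝ) * m :=
    ⟨max m₀ 1, le_max_right _ _, hm₀ _ (le_max_left _ _)⟩
  refine ⟨m, hm1, fun V hV => ?_⟩
  have hM1 : (1 : ℝ) ≤ m := by exact_mod_cast hm1
  have hN : (((n * m : ℕ) : ℝ)) = (n : ℝ) * m := by push_cast; ring
  rw [hN] at hV
  have hloss := loss_le_exp_n hn0 hM1 hmm
  have hmain : Real.exp ((n : ℝ) * m * h) ≤ (V : ℝ) * Real.exp (δ * a * Real.log (q : ℝ) * m) :=
    calc Real.exp ((n : ℝ) * m * h)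
        ≤ (V : ℝ) * ((n : ℝ) * m + 1) ^ 63 * 192 *
            Real.exp (4 * √(Real.log 6 + (n : ℝ) * m * Real.log 27)) := hV
      _ = (V : ℝ) * (((n : ℝ) * m + 1) ^ 63 * 192 *
            Real.exp (4 * √(Real.log 6 + (n : ℝ) * m * Real.log 27))) := by
          rw [mul_assoc (V : ℝ), mul_assoc (V : ℝ)]
      _ ≤ (V : ℝ) * Real.exp (δ * a * Real.log (q : ℝ) * m) :=
          mul_le_mul_of_nonneg_left hloss (Nat.cast_nonneg V)
  have hkey : 1 ≤ (V : ℝ) * Real.exp (δ * a * Real.log (q : ℝ) * m - (n : ℝ) * m * h) := by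
    rw [Real.exp_sub, mul_div_assoc', one_le_div (Real.exp_pos _)]
    exact hmain
  have hqm : (0 : ℝ) < (q : ℝ) ^ (a * m) := pow_pos hq0 _
  have hcast : ((q ^ (a * m) : ℕ) : ℝ) = (q : ℝ) ^ (a * m) := by push_cast; rfl
  have hq2 : (0 : ℝ) < (q : ℝ) + 2 := by positivity
  have hA : Real.exp ((n : ℝ) * m * Real.log ((q : ℝ) + 2)) = ((q : ℝ) + 2) ^ (n * m) := by
    rw [← Real.exp_log (pow_pos hq2 (n * m)), Real.log_pow]
    congr 1
    push_cast
    ring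
  have halg : Real.log ((q : ℝ) ^ (a * m)) *
      ((n : ℝ) * (Real.log ((q : ℝ) + 2) - h) / ((a : ℝ) * Real.log (q : ℝ)) + δ) =
      (n : ℝ) * m * Real.log ((q : ℝ) + 2) + (δ * a * Real.log (q : ℝ) * m - (n : ℝ) * m * h) := by
    rw [Real.log_pow]
    push_cast
    field_simp
    ring
  rw [hcast, Real.rpow_def_of_pos hqm, halg, Real.exp_add, hA]
  have hP : 0 ≤ ((q : ℝ) + 2) ^ (n * m) := by positivity
  calc ((q : ℝ) + 2) ^ (n * m) = 1 * ((q : ℝ) + 2) ^ (n * m) := (one_mul _).symm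
    _ ≤ ((V : ℝ) * Real.exp (δ * a * Real.log (q : ℝ) * m - (n : ℝ) * m * h)) *
          ((q : ℝ) + 2) ^ (n * m) := mul_le_mul_of_nonneg_right hkey hP
    _ = (V : ℝ) * (((q : ℝ) + 2) ^ (n * m) *
          Real.exp (δ * a * Real.log (q : ℝ) * m - (n : ℝ) * m * h)) := by ring

/-! ### §4  The packing certificate of the five-pattern type and `ω(1,1,k) ≤ F(a,b,c,q)` -/

/-- **Packing certificate** (stub A, §1–§3): for `q ≥ 2`, `a ≥ 1`, `k a ≤ b`, `δ > 0` there are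
`N, V ≥ 1`, `A ≥ 2`, `B ≥ A^k` with `CW_q^{⊗N} ⊵ ⟨V⟩ ⊗ ⟨A, A, B⟩` and `(q+2)^N ≤ V · A^{F+δ}`,
`F = n (log(q+2) − min(H_X,H_Y))/(a log q)`; witnesses `N = n m`, `V = |Δ|`, `A = q^{a m}`, `B = q^{b m}`. -/
theorem fp_packing (q a b c k : ℕ) (hq : 2 ≤ q) (ha : 1 ≤ a) (hb : k * a ≤ b) (δ : ℝ) (hδ : 0 < δ) :
    ∃ N V A B : ℕ, 1 ≤ N ∧ 1 ≤ V ∧ 2 ≤ A ∧ A ^ k ≤ B ∧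
      PolyDegeneratesTo (kroneckerPow (bigCwTensor ℂ q) N)
        (kroneckerTensor (unitTensor ℂ V) (matMulTensor ℂ A A B)) ∧
      ((q : ℝ) + 2) ^ N ≤ (V : ℝ) * (A : ℝ) ^
        (((2 * a + b + 2 * c : ℕ) : ℝ) * (Real.log ((q : ℝ) + 2) -
            min (Real.negMulLog (((a : ℝ) + c) / ((2 * a + b + 2 * c : ℕ) : ℝ)) +
                  Real.negMulLog (((a : ℝ) + b) / ((2 * a + b + 2 * c : ℕ) : ℝ)) +
                  Real.negMulLog ((c : ℝ) / ((2 * a + b + 2 * c : ℕ) : ℝ)))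
                (Real.negMulLog (((b : ℝ) + 2 * c) / ((2 * a + b + 2 * c : ℕ) : ℝ)) +
                  Real.negMulLog (2 * (a : ℝ) / ((2 * a + b + 2 * c : ℕ) : ℝ)))) /
            ((a : ℝ) * Real.log (q : ℝ)) + δ) := by
  obtain ⟨m, hm, hC⟩ := fp_threshold q (2 * a + b + 2 * c) a hq (by omega) ha
    (min (Real.negMulLog (((a : ℝ) + c) / ((2 * a + b + 2 * c : ℕ) : ℝ)) +
          Real.negMulLog (((a : ℝ) + b) / ((2 * a + b + 2 * c : ℕ) : ℝ)) +
          Real.negMulLog ((c : ℝ) / ((2 * a + b + 2 * c : ℕ) : ℝ)))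
        (Real.negMulLog (((b : ℝ) + 2 * c) / ((2 * a + b + 2 * c : ℕ) : ℝ)) +
          Real.negMulLog (2 * (a : ℝ) / ((2 * a + b + 2 * c : ℕ) : ℝ)))) δ hδ
  obtain ⟨Δ, hS, hcnt, hfree, hsize⟩ := fp_diagonal a b c m ha hm
  have hres := stub_cwRectRestriction q (a * m) (a * m) (b * m) ((2 * a + b + 2 * c) * m) Δ hS hcnt
    hfree
  refine ⟨(2 * a + b + 2 * c) * m, Δ.card, q ^ (a * m), q ^ (b * m), ?_, ?_, ?_, ?_,
    hres.polyDegeneratesTo, hC Δ.card hsize⟩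
  · exact Nat.mul_pos (by omega) (by omega)
  · by_contra h0
    have h0' : Δ.card = 0 := by omega
    rw [h0', Nat.cast_zero, zero_mul, zero_mul, zero_mul] at hsize
    exact absurd hsize (not_le.2 (Real.exp_pos _))
  · exact le_trans hq (Nat.le_self_pow (Nat.mul_pos (by omega) (by omega)).ne' q)
  · rw [← pow_mul]
    exact Nat.pow_le_pow_right (by omega) (by nlinarith [hb])

/-- **Layers 1–2, generic form**: a packing certificate `(q+2)^N ≤ V · a^{f+δ}` for every `δ > 0`
with `CW_q^{⊗N} ⊵ ⟨V⟩ ⊗ ⟨a, a, B⟩`, `B ≥ a^k`, gives `ω(1,1,k) ≤ f`. -/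
theorem omegaRect_le_of_packing' {k q : ℕ} {f : ℝ}
    (hP : ∀ δ : ℝ, 0 < δ → ∃ N V a B : ℕ, 1 ≤ N ∧ 1 ≤ V ∧ 2 ≤ a ∧ a ^ k ≤ B ∧
        PolyDegeneratesTo (kroneckerPow (bigCwTensor ℂ q) N)
          (kroneckerTensor (unitTensor ℂ V) (matMulTensor ℂ a a B)) ∧
        ((q : ℝ) + 2) ^ N ≤ (V : ℝ) * (a : ℝ) ^ (f + δ)) :
    omegaRect ℂ 1 1 (k : ℝ) ≤ f := by
  refine le_of_forall_pos_lt_add fun δ hδ => ?_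
  obtain ⟨N, V, a, B, hN, hV, ha, haB, hdeg, hnum⟩ := hP (δ / 2) (half_pos hδ)
  have ha1 : (1 : ℝ) < a := by exact_mod_cast (by omega : 1 < a)
  have hV0 : (0 : ℝ) < V := by exact_mod_cast (by omega : 0 < V)
  have hk0 : (0 : ℝ) ≤ (k : ℝ) := Nat.cast_nonneg k
  have haB' : (a : ℝ) ^ (k : ℝ) ≤ (B : ℝ) := by
    rw [Real.rpow_natCast]
    exact_mod_cast haB
  have h1 := mul_rpow_omegaRect_le_asymptoticRank ℂ hk0 hV ha haB'
  have h2 := asymptoticRank_le_of_polyDegeneratesTo hdeg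
  have hcw : asymptoticRank (bigCwTensor ℂ q) ≤ (q : ℝ) + 2 := by
    exact_mod_cast asymptoticRank_bigCwTensor_le ℂ q
  have h3 : asymptoticRank (kroneckerPow (bigCwTensor ℂ q) N) ≤ ((q : ℝ) + 2) ^ N :=
    (asymptoticRank_kroneckerPow_le _ hN).trans
      (pow_le_pow_left₀ (asymptoticRank_nonneg _) hcw N)
  have hchain : (V : ℝ) * (a : ℝ) ^ omegaRect ℂ 1 1 (k : ℝ) ≤ (V : ℝ) * (a : ℝ) ^ (f + δ / 2) :=
    h1.trans (h2.trans (h3.trans hnum))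
  have h4 : (a : ℝ) ^ omegaRect ℂ 1 1 (k : ℝ) ≤ (a : ℝ) ^ (f + δ / 2) :=
    le_of_mul_le_mul_left hchain hV0
  have h5 : omegaRect ℂ 1 1 (k : ℝ) ≤ f + δ / 2 := (Real.rpow_le_rpow_left_iff ha1).1 h4
  linarith

/-- **`ω(1,1,k) ≤ F(a,b,c,q)`** — the full first power of `CW_q` with the five-pattern type. -/
theorem fp_omegaRect_le (q a b c k : ℕ) (hq : 2 ≤ q) (ha : 1 ≤ a) (hb : k * a ≤ b) :
    omegaRect ℂ 1 1 (k : ℝ) ≤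
      ((2 * a + b + 2 * c : ℕ) : ℝ) * (Real.log ((q : ℝ) + 2) -
          min (Real.negMulLog (((a : ℝ) + c) / ((2 * a + b + 2 * c : ℕ) : ℝ)) +
                Real.negMulLog (((a : ℝ) + b) / ((2 * a + b + 2 * c : ℕ) : ℝ)) +
                Real.negMulLog ((c : ℝ) / ((2 * a + b + 2 * c : ℕ) : ℝ)))
              (Real.negMulLog (((b : ℝ) + 2 * c) / ((2 * a + b + 2 * c : ℕ) : ℝ)) +
                Real.negMulLog (2 * (a : ℝ) / ((2 * a + b + 2 * c : ℕ) : ℝ)))) /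
        ((a : ℝ) * Real.log (q : ℝ)) :=
  omegaRect_le_of_packing' fun δ hδ => fp_packing q a b c k hq ha hb δ hδ

/-! ### §5  The certificate checker: `e(k) ≤ η` from two log-linear inequalities -/

/-- `n · η(x/n) = x log n − x log x` for `n > 0`, `x ≥ 0` (`η = negMulLog`). [folklore] -/
theorem mul_negMulLog_div {x n : ℝ} (hn : 0 < n) (hx : 0 ≤ x) :
    n * Real.negMulLog (x / n) = x * Real.log n - x * Real.log x := by
  rcases hx.eq_or_lt with h0 | hx0
  · rw [← h0]
    simp
  · rw [Real.negMulLog, Real.log_div hx0.ne' hn.ne']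
    field_simp
    ring

/-- **Certificate checker.**  With `n = 2a+b+2c` and `k a ≤ b`, the bound `e(k) ≤ η` follows from
`n log(q+2) − a(k+1+η) log q ≤ n·H_X = n log n − (a+c)log(a+c) − (a+b)log(a+b) − c log c` and
`… ≤ n·H_Y = n log n − (b+2c)log(b+2c) − 2a log(2a)` — each, after clearing denominators, a
comparison of two products of integer powers. -/
theorem fp_cert {q a b c k : ℕ} (hq : 2 ≤ q) (ha : 1 ≤ a) (hb : k * a ≤ b) {η : ℝ}
    (hX : ((2 * a + b + 2 * c : ℕ) : ℝ) * Real.log ((q : ℝ) + 2) -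
        (a : ℝ) * ((k : ℝ) + 1 + η) * Real.log (q : ℝ) ≤
      ((2 * a + b + 2 * c : ℕ) : ℝ) * Real.log ((2 * a + b + 2 * c : ℕ) : ℝ) -
        ((a : ℝ) + c) * Real.log ((a : ℝ) + c) - ((a : ℝ) + b) * Real.log ((a : ℝ) + b) -
        (c : ℝ) * Real.log (c : ℝ))
    (hY : ((2 * a + b + 2 * c : ℕ) : ℝ) * Real.log ((q : ℝ) + 2) -
        (a : ℝ) * ((k : ℝ) + 1 + η) * Real.log (q : ℝ) ≤
      ((2 * a + b + 2 * c : ℕ) : ℝ) * Real.log ((2 * a + b + 2 * c : ℕ) : ℝ) -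
        ((b : ℝ) + 2 * c) * Real.log ((b : ℝ) + 2 * c) - 2 * (a : ℝ) * Real.log (2 * (a : ℝ))) :
    omegaRect ℂ 1 (k : ℝ) 1 - ((k : ℝ) + 1) ≤ η := by
  set n : ℝ := ((2 * a + b + 2 * c : ℕ) : ℝ) with hn
  have hn0 : (0 : ℝ) < n := by rw [hn]; exact_mod_cast (by omega : 0 < 2 * a + b + 2 * c)
  have hncast : n = 2 * (a : ℝ) + b + 2 * c := by rw [hn]; push_cast; ring
  have hq1 : (1 : ℝ) < q := by exact_mod_cast (lt_of_lt_of_le one_lt_two hq)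
  have hL : 0 < Real.log (q : ℝ) := Real.log_pos hq1
  have ha0 : (0 : ℝ) < a := by exact_mod_cast (by omega : 0 < a)
  have hF := fp_omegaRect_le q a b c k hq ha hb
  rw [← hn] at hF
  set HX : ℝ := Real.negMulLog (((a : ℝ) + c) / n) + Real.negMulLog (((a : ℝ) + b) / n) +
    Real.negMulLog ((c : ℝ) / n) with hHX
  set HY : ℝ := Real.negMulLog (((b : ℝ) + 2 * c) / n) + Real.negMulLog (2 * (a : ℝ) / n) with hHY
  have eX : n * HX = n * Real.log n - ((a : ℝ) + c) * Real.log ((a : ℝ) + c) -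
      ((a : ℝ) + b) * Real.log ((a : ℝ) + b) - (c : ℝ) * Real.log (c : ℝ) := by
    rw [hHX, mul_add, mul_add, mul_negMulLog_div hn0 (by positivity),
      mul_negMulLog_div hn0 (by positivity), mul_negMulLog_div hn0 (by positivity)]
    have hs : n * Real.log n = (((a : ℝ) + c) + ((a : ℝ) + b) + c) * Real.log n := by
      rw [hncast]; ring
    rw [hs]
    ring
  have eY : n * HY = n * Real.log n - ((b : ℝ) + 2 * c) * Real.log ((b : ℝ) + 2 * c) -
      2 * (a : ℝ) * Real.log (2 * (a : ℝ)) := by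
    rw [hHY, mul_add, mul_negMulLog_div hn0 (by positivity), mul_negMulLog_div hn0 (by positivity)]
    have hs : n * Real.log n = (((b : ℝ) + 2 * c) + 2 * (a : ℝ)) * Real.log n := by
      rw [hncast]; ring
    rw [hs]
    ring
  have hmin : n * Real.log ((q : ℝ) + 2) - (a : ℝ) * ((k : ℝ) + 1 + η) * Real.log (q : ℝ) ≤
      n * min HX HY := by
    rw [mul_min_of_nonneg _ _ hn0.le, eX, eY]
    exact le_min hX hY
  have hapos : 0 < (a : ℝ) * Real.log (q : ℝ) := mul_pos ha0 hL
  have h2 : n * (Real.log ((q : ℝ) + 2) - min HX HY) / ((a : ℝ) * Real.log (q : ℝ)) ≤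
      (k : ℝ) + 1 + η := by
    rw [div_le_iff₀ hapos]
    linarith
  rw [omegaRect_one_mid_one]
  linarith

end Summit.MatrixMultiplication.MatrixMultiplication.Theorems.OctaveBudgetFivePattern

end
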